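import Literature.MathematicalPhysics.QuantumLattice.GrassmannKernelExpansion
import Literature.Probability.LatticeModels.CumulantExponentialAnalytic
import Mathlib.Analysis.Matrix.Normed
import Mathlib.LinearAlgebra.Matrix.ToLin
import Mathlib.Topology.Algebra.Module.FiniteDimension
import HarnessLib

/-!
# The effective action is the convergent sum of the truncated expectations: `𝒱' = -Σ_n 𝓔ᵀ_C(-V; n)/n!`

Topic `Literature/MathematicalPhysics/QuantumLattice`.  The identity by which the renormalisation group DEFINES
the effective potential of the next scale (Benfatto–Giuliani–Mastropietro 2006, (2.13)–(2.14); Mastropietro 2008,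
(2.36), (2.47)–(2.53); Gawȩdzki–Kupiainen 1985, §3): for an even interaction `V` without constant term on the
finite label set `Γ`, IF the cumulant series `Σ_n κ_n/n!`, `κ_n = 𝓔ᵀ_C(-V; n) = cumulantOf (k ↦ e^{Δ_C}((-V)^k)) n`,
converges absolutely (kernel-wise), THEN the normalised partition function `Z = ∫dμ_C e^{-V}` is a unit and the
Wilsonian effective action `effAction C V = -log (Z⁻¹ ∫ dμ_C(χ) e^{-V(χ+ψ)})` (`GrassmannEffectiveAction.lean`,
an exact finite `log1p`) has the kernels of `-Σ_n κ_n/n!` in every degree `m ≥ 1`: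

`kernel (effAction C V) m Y = - Σ'_n (n!)⁻¹ kernel (κ_n) m Y`   (`kernel_effAction_eq_neg_tsum`).

Mechanism.  The even part `⋀^{even}` is a finite-dimensional commutative `𝕜`-algebra; its left-regular matrix
representation makes it a commutative Banach algebra with `‖1‖ = 1` (local instances `evenPartNormedCommRing`, …).
There the analytic exponential formula (`CumulantExponentialAnalytic.tsum_egf_eq_exp_tsum_egfPos_cumulantOf`)
gives `e^{Δ_C}(e^{-V}) = exp S`, `S = Σ_n κ_n/n!`; the constant part is a continuous character, so
`Z = exp (constPart S) ≠ 0` and `Z⁻¹ e^{Δ_C}(e^{-V}) = exp S₀`, `S₀ = S - constPart S` nilpotent, whose Banach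
exponential is the finite `grassmannExp`; finally `log1p (grassmannExp S₀ - 1) = S₀`
(`grassmannLog1p_grassmannExp_sub_one`).

* `evenRep` (faithful matrix representation), `evenPartNormedCommRing`, `evenPartNormedAlgebra`, … (local);
  `norm_le_sum_norm_kernel` — `‖x‖ ≤ Σ_{m',Y} ‖kernel x (2m') Y‖ ‖ψ(Y)‖`;
* `kernel_algebraMap_eq_zero`, `coe_qsmul_evenPart`;
* **`isUnit_effPartitionFn_of_summable`**, **`kernel_effAction_eq_neg_tsum`**.

Everything is proved; no named fact.

## Sources

G. Benfatto, A. Giuliani, V. Mastropietro, Ann. Henri Poincaré 7 (2006) 809–898, (2.13)–(2.14)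
(`BenfattoGiulianiMastropietro2006`); V. Mastropietro, *Non-Perturbative Renormalization* (2008), §2.3 (2.36),
§2.5 (2.47)–(2.53) (`Mastropietro2008`); K. Gawȩdzki, A. Kupiainen, Comm. Math. Phys. 102 (1985) 1–30, §3
(`GawedzkiKupiainen1985GrossNeveu`).
-/

noncomputable section

namespace Literature.MathematicalPhysics.QuantumLattice

open GrassmannAlgebra Finset Literature.Probability.LatticeModels PowerSeries
open scoped Nat

section Banach

variable (𝕜 : Type*) [RCLike 𝕜] (Γ : Type*) [Fintype Γ] [DecidableEq Γ]

/-- The Grassmann algebra on a finite label set is finite-dimensional. [folklore] -/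
instance instFiniteDimensionalGrassmann : FiniteDimensional 𝕜 (GrassmannAlgebra 𝕜 Γ) :=
  letI : LinearOrder Γ := LinearOrder.lift' (Fintype.equivFin Γ) (Fintype.equivFin Γ).injective
  Module.Finite.of_basis (grassmannBasis 𝕜 Γ)

/-- So is its even part. [folklore] -/
instance instFiniteDimensionalEvenPart : FiniteDimensional 𝕜 (evenPart 𝕜 Γ) :=
  FiniteDimensional.of_injective (evenPart 𝕜 Γ).val.toLinearMap Subtype.val_injective

/-- The index type of the chosen basis of `⋀^{even}`. [folklore] -/
abbrev evenIdx : Type := Fin (Module.finrank 𝕜 (evenPart 𝕜 Γ))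

/-- The basis is nonempty (`1 ≠ 0`). [folklore] -/
instance instNonemptyEvenIdx : Nonempty (evenIdx 𝕜 Γ) := ⟨⟨0, Module.finrank_pos⟩⟩

/-- **The faithful matrix representation of `⋀^{even}`** (left-regular representation in the chosen basis).
[folklore] -/
def evenRep : evenPart 𝕜 Γ →ₐ[𝕜] Matrix (evenIdx 𝕜 Γ) (evenIdx 𝕜 Γ) 𝕜 :=
  (LinearMap.toMatrixAlgEquiv (Module.finBasis 𝕜 (evenPart 𝕜 Γ))).toAlgHom.comp (Algebra.lmul 𝕜 (evenPart 𝕜 Γ))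

omit [DecidableEq Γ] in
/-- The representation is faithful. [folklore] -/
theorem evenRep_injective : Function.Injective (evenRep 𝕜 Γ) :=
  (LinearMap.toMatrixAlgEquiv (Module.finBasis 𝕜 (evenPart 𝕜 Γ))).injective.comp Algebra.lmul_injective

/-- **`⋀^{even}` as a commutative Banach algebra** (norm induced by the matrix representation, sup-of-row-sums
operator norm).  A local instance only. [folklore] -/
abbrev evenPartNormedCommRing : NormedCommRing (evenPart 𝕜 Γ) :=
  letI : NormedRing (Matrix (evenIdx 𝕜 Γ) (evenIdx 𝕜 Γ) 𝕜) := Matrix.linftyOpNormedRing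
  NormedCommRing.induced (evenPart 𝕜 Γ) (Matrix (evenIdx 𝕜 Γ) (evenIdx 𝕜 Γ) 𝕜) (evenRep 𝕜 Γ) (evenRep_injective 𝕜 Γ)

attribute [local instance] evenPartNormedCommRing

/-- … as a normed `𝕜`-algebra. [folklore] -/
abbrev evenPartNormedAlgebra : NormedAlgebra 𝕜 (evenPart 𝕜 Γ) :=
  letI : NormedRing (Matrix (evenIdx 𝕜 Γ) (evenIdx 𝕜 Γ) 𝕜) := Matrix.linftyOpNormedRing
  letI : NormedAlgebra 𝕜 (Matrix (evenIdx 𝕜 Γ) (evenIdx 𝕜 Γ) 𝕜) := Matrix.linftyOpNormedAlgebra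
  NormedAlgebra.induced 𝕜 (evenPart 𝕜 Γ) (Matrix (evenIdx 𝕜 Γ) (evenIdx 𝕜 Γ) 𝕜) (evenRep 𝕜 Γ)

attribute [local instance] evenPartNormedAlgebra

omit [DecidableEq Γ] in
/-- `‖1‖ = 1`. [folklore] -/
theorem evenPart_normOneClass : NormOneClass (evenPart 𝕜 Γ) := by
  letI : NormedRing (Matrix (evenIdx 𝕜 Γ) (evenIdx 𝕜 Γ) 𝕜) := Matrix.linftyOpNormedRing
  exact ⟨show ‖evenRep 𝕜 Γ 1‖ = 1 by rw [map_one, norm_one]⟩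

attribute [local instance] evenPart_normOneClass

omit [DecidableEq Γ] in
/-- Completeness (finite dimension). [folklore] -/
theorem evenPart_completeSpace : CompleteSpace (evenPart 𝕜 Γ) := FiniteDimensional.complete 𝕜 (evenPart 𝕜 Γ)

attribute [local instance] evenPart_completeSpace

/-- … as a normed `ℚ`-algebra (through `ℚ → 𝕜`). [folklore] -/
abbrev evenPartNormedAlgebraRat : NormedAlgebra ℚ (evenPart 𝕜 Γ) :=
  { (inferInstance : Algebra ℚ (evenPart 𝕜 Γ)) with
    norm_smul_le := fun q x => by
      rw [← Rat.cast_smul_eq_qsmul 𝕜 q x]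
      refine (norm_smul_le _ _).trans (le_of_eq ?_)
      rw [← RCLike.ofReal_ratCast, RCLike.norm_ofReal, ← Rat.norm_cast_real, Real.norm_eq_abs] }

attribute [local instance] evenPartNormedAlgebraRat

/-- **The norm is dominated by the kernels**: `‖x‖ ≤ Σ_{m' ≤ |Γ|/2} Σ_Y ‖kernel x (2m') Y‖ ‖ψ(Y)‖`. [folklore] -/
theorem norm_le_sum_norm_kernel (x : evenPart 𝕜 Γ) :
    ‖x‖ ≤ ∑ m' ∈ range (Fintype.card Γ / 2 + 1), ∑ Y : Fin (2 * m') → Γ,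
      ‖kernel 𝕜 (x : GrassmannAlgebra 𝕜 Γ) (2 * m') Y‖ * ‖(evenGenProd (R := 𝕜) (even_two_mul m') Y : evenPart 𝕜 Γ)‖ := by
  have hx : x = vertexOf 𝕜 (range (Fintype.card Γ / 2 + 1)) (fun m' => kernel 𝕜 (x : GrassmannAlgebra 𝕜 Γ) (2 * m')) :=
    Subtype.ext (coe_vertexOf_kernel_eq 𝕜 x).symm
  conv_lhs => rw [hx, vertexOf]
  refine (norm_sum_le _ _).trans (sum_le_sum fun m' _ => (norm_sum_le _ _).trans (sum_le_sum fun Y _ => ?_))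
  rw [norm_smul]

/-! ### Kernels as continuous functionals; scalars; `ℚ`-multiples -/

/-- The kernel functional `F ↦ kernel F m Y`. [folklore] -/
def kernelLM (m : ℕ) (Y : Fin m → Γ) : GrassmannAlgebra 𝕜 Γ →ₗ[𝕜] 𝕜 where
  toFun F := kernel 𝕜 F m Y
  map_add' F G := kernel_add 𝕜 F G m Y
  map_smul' r F := kernel_smul 𝕜 r F m Y

omit [Fintype Γ] [DecidableEq Γ] in
/-- Unfolding `kernelLM`. [folklore] -/
@[simp] theorem kernelLM_apply (m : ℕ) (Y : Fin m → Γ) (F : GrassmannAlgebra 𝕜 Γ) : kernelLM 𝕜 Γ m Y F = kernel 𝕜 F m Y := rfl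

omit [Fintype Γ] [DecidableEq Γ] in
/-- **Scalars have no kernels in positive degree.** [folklore] -/
theorem kernel_algebraMap_eq_zero (c : 𝕜) {m : ℕ} (hm : 0 < m) (Y : Fin m → Γ) :
    kernel 𝕜 (algebraMap 𝕜 (GrassmannAlgebra 𝕜 Γ) c) m Y = 0 := by
  obtain ⟨m, rfl⟩ := Nat.exists_eq_succ_of_ne_zero hm.ne'
  rw [kernel_def, iterDeriv_succ_apply, grassmannDeriv_algebraMap, map_zero, map_zero, mul_zero]

omit [DecidableEq Γ] in
/-- `ℚ`-multiples in `⋀^{even}` are `𝕜`-multiples. [folklore] -/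
theorem coe_qsmul_evenPart (q : ℚ) (x : evenPart 𝕜 Γ) :
    ((q • x : evenPart 𝕜 Γ) : GrassmannAlgebra 𝕜 Γ) = (q : 𝕜) • (x : GrassmannAlgebra 𝕜 Γ) := by
  rw [← Rat.cast_smul_eq_qsmul 𝕜 q x, Subalgebra.coe_smul]

/-! ### The theorem -/

/-- **The effective action is the sum of the truncated expectations** (Benfatto–Giuliani–Mastropietro 2006,
(2.13)–(2.14); Mastropietro 2008, (2.36), (2.50)–(2.53)): for an even `V` without constant term whose cumulant
series `Σ_n κ_n/n!`, `κ_n = cumulantOf (k ↦ e^{Δ_C}((-V)^k)) n = 𝓔ᵀ_C(-V; n)`, converges absolutely kernel by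
kernel, the normalised partition function is a unit and, in every degree `m ≥ 1`,
`kernel (effAction C V) m Y = -Σ'_n (n!)⁻¹ kernel (κ_n) m Y`. [cite: BenfattoGiulianiMastropietro2006, (2.13)-(2.14)] -/
theorem kernel_effAction_eq_neg_tsum (C : Matrix Γ Γ 𝕜) (V : GrassmannAlgebra 𝕜 Γ) (hV : V ∈ evenPart 𝕜 Γ)
    (hV0 : constPart 𝕜 V = 0)
    (hsum : ∀ (m' : ℕ) (Y : Fin (2 * m') → Γ), Summable fun n : ℕ =>
      ‖kernel 𝕜 ((cumulantOf (fun k => evenGaussConv 𝕜 C ((⟨-V, neg_mem hV⟩ : evenPart 𝕜 Γ) ^ k)) n : evenPart 𝕜 Γ) :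
        GrassmannAlgebra 𝕜 Γ) (2 * m') Y‖ / n !) :
    IsUnit (effPartitionFn 𝕜 C V) ∧ ∀ {m : ℕ}, 0 < m → ∀ Y : Fin m → Γ,
      kernel 𝕜 (effAction 𝕜 C V) m Y = -∑' n : ℕ, (if n = 0 then 0 else
        ((n ! : 𝕜))⁻¹ * kernel 𝕜 ((cumulantOf (fun k => evenGaussConv 𝕜 C ((⟨-V, neg_mem hV⟩ : evenPart 𝕜 Γ) ^ k)) n :
          evenPart 𝕜 Γ) : GrassmannAlgebra 𝕜 Γ) m Y) := by
  set X : evenPart 𝕜 Γ := ⟨-V, neg_mem hV⟩ with hX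
  set μ : ℕ → evenPart 𝕜 Γ := fun k => evenGaussConv 𝕜 C (X ^ k) with hμ
  have hμ0 : μ 0 = 1 := Subtype.ext (by rw [hμ]; simp only [pow_zero, coe_evenGaussConv, OneMemClass.coe_one, gaussConv_one])
  -- (1) the cumulant egf is norm-summable in the Banach algebra `⋀^{even}`
  have hK : NormSummable (egfPos (cumulantOf μ)) := by
    set w : ℕ → ℝ := fun n => (n ! : ℝ)⁻¹ * ∑ m' ∈ range (Fintype.card Γ / 2 + 1), ∑ Y : Fin (2 * m') → Γ,
      ‖kernel 𝕜 ((cumulantOf μ n : evenPart 𝕜 Γ) : GrassmannAlgebra 𝕜 Γ) (2 * m') Y‖ *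
        ‖(evenGenProd (R := 𝕜) (even_two_mul m') Y : evenPart 𝕜 Γ)‖ with hw
    have hws : Summable w := by
      have h : ∀ n, w n = ∑ m' ∈ range (Fintype.card Γ / 2 + 1), ∑ Y : Fin (2 * m') → Γ,
          ‖kernel 𝕜 ((cumulantOf μ n : evenPart 𝕜 Γ) : GrassmannAlgebra 𝕜 Γ) (2 * m') Y‖ / n ! *
            ‖(evenGenProd (R := 𝕜) (even_two_mul m') Y : evenPart 𝕜 Γ)‖ := fun n => by
        rw [hw]
        dsimp only
        rw [mul_sum]
        refine sum_congr rfl fun m' _ => ?_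
        rw [mul_sum]
        refine sum_congr rfl fun Y _ => ?_
        rw [div_eq_inv_mul]
        ring
      exact (summable_congr h).2 (summable_sum fun m' _ => summable_sum fun Y _ => (hsum m' Y).mul_right _)
    refine Summable.of_nonneg_of_le (fun n => norm_nonneg _) (fun n => ?_) hws
    rw [egfPos, coeff_egf, ← Algebra.smul_def]
    refine (norm_inv_factorial_smul_le n _).trans (mul_le_mul_of_nonneg_left ?_ (by positivity))
    split_ifs with hn
    · rw [norm_zero]
      exact sum_nonneg fun m' _ => sum_nonneg fun Y _ => by positivity
    · exact norm_le_sum_norm_kernel 𝕜 Γ _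
  -- (2) the analytic exponential formula
  obtain ⟨-, hev⟩ := tsum_egf_eq_exp_tsum_egfPos_cumulantOf μ hμ0 hK
  set S : evenPart 𝕜 Γ := ev (egfPos (cumulantOf μ)) with hS
  -- (3) `ev (egf μ)` is the finite Boltzmann sum
  have hnilV : (-V) ^ (Fintype.card Γ + 1) = 0 := pow_card_succ_eq_zero_of_constPart_eq_zero 𝕜 (by rw [map_neg, hV0, neg_zero])
  have hXpow : ∀ k, Fintype.card Γ + 1 ≤ k → X ^ k = 0 := fun k hk =>
    Subtype.ext (by rw [SubmonoidClass.coe_pow, ZeroMemClass.coe_zero]; exact pow_eq_zero_of_le hk hnilV)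
  have hμvan : ∀ k, Fintype.card Γ + 1 ≤ k → μ k = 0 := fun k hk => by
    rw [hμ]
    dsimp only
    rw [hXpow k hk, map_zero]
  have hevP : ev (egf μ) = ∑ k ∈ range (Fintype.card Γ + 1), ((k ! : ℚ)⁻¹) • μ k := by
    rw [ev, tsum_eq_sum (s := range (Fintype.card Γ + 1)) fun k hk => by
      rw [coeff_egf, hμvan k (by simpa using hk), mul_zero]]
    exact sum_congr rfl fun k _ => by rw [coeff_egf, Algebra.smul_def]
  have hBoltz : ((ev (egf μ) : evenPart 𝕜 Γ) : GrassmannAlgebra 𝕜 Γ) = effBoltzmann 𝕜 C V := by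
    rw [hevP, AddSubmonoidClass.coe_finsetSum, effBoltzmann_def, grassmannExp, IsNilpotent.exp_eq_sum hnilV, map_sum]
    refine sum_congr rfl fun k _ => ?_
    rw [coe_qsmul_evenPart, hμ]
    dsimp only
    rw [coe_evenGaussConv, SubmonoidClass.coe_pow, ← Rat.cast_smul_eq_qsmul 𝕜, map_smul]
  -- (4) the constant part is a continuous character: `Z = exp c`
  set χ : evenPart 𝕜 Γ →ₐ[𝕜] 𝕜 := (constPart 𝕜).comp (evenPart 𝕜 Γ).val with hχ
  have hχc : Continuous χ := χ.toLinearMap.continuous_of_finiteDimensional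
  set c : 𝕜 := χ S with hc
  have hZ : effPartitionFn 𝕜 C V = NormedSpace.exp c := by
    rw [effPartitionFn, ← hBoltz, hev]
    exact NormedSpace.map_exp χ hχc S
  have hunit : IsUnit (effPartitionFn 𝕜 C V) := by
    rw [hZ]
    exact NormedSpace.isUnit_exp c
  -- (5) `Z⁻¹ • B = exp S₀`, `S₀ = S - c`
  set S₀ : evenPart 𝕜 Γ := S - algebraMap 𝕜 (evenPart 𝕜 Γ) c with hS₀
  have hSdec : S = algebraMap 𝕜 (evenPart 𝕜 Γ) c + S₀ := by rw [hS₀]; abel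
  have hexpS : NormedSpace.exp S = algebraMap 𝕜 (evenPart 𝕜 Γ) (NormedSpace.exp c) * NormedSpace.exp S₀ := by
    rw [hSdec, NormedSpace.exp_add, ← NormedSpace.algebraMap_exp_comm c]
  have hexpc0 : NormedSpace.exp c ≠ 0 := (NormedSpace.isUnit_exp c).ne_zero
  have hratio : Ring.inverse (effPartitionFn 𝕜 C V) • effBoltzmann 𝕜 C V - 1 =
      ((NormedSpace.exp S₀ : evenPart 𝕜 Γ) : GrassmannAlgebra 𝕜 Γ) - 1 := by
    rw [← hBoltz, hev, hexpS, Subalgebra.coe_mul, Subalgebra.coe_algebraMap, hZ, Ring.inverse_eq_inv', ← Algebra.smul_def,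
      smul_smul, inv_mul_cancel₀ hexpc0, one_smul]
  -- (6) `S₀` is nilpotent: its Banach exponential is the finite `grassmannExp`
  have hχS₀ : constPart 𝕜 (S₀ : GrassmannAlgebra 𝕜 Γ) = 0 := by
    show χ S₀ = 0
    rw [hS₀, map_sub, AlgHom.commutes, Algebra.algebraMap_self, RingHom.id_apply, hc, sub_self]
  have hS₀nilA : (S₀ : GrassmannAlgebra 𝕜 Γ) ^ (Fintype.card Γ + 1) = 0 := pow_card_succ_eq_zero_of_constPart_eq_zero 𝕜 hχS₀
  have hS₀nil : S₀ ^ (Fintype.card Γ + 1) = 0 := Subtype.ext (by rw [SubmonoidClass.coe_pow, ZeroMemClass.coe_zero]; exact hS₀nilA)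
  have hexpS₀ : NormedSpace.exp S₀ = ∑ d ∈ range (Fintype.card Γ + 1), ((d ! : ℚ)⁻¹) • S₀ ^ d := by
    rw [show NormedSpace.exp S₀ = ∑' d : ℕ, ((d ! : ℚ)⁻¹) • S₀ ^ d from congrFun NormedSpace.exp_eq_tsum_rat S₀,
      tsum_eq_sum fun d hd => ?_]
    rw [mem_range, not_lt] at hd
    rw [pow_eq_zero_of_le hd hS₀nil, smul_zero]
  have hcoe_expS₀ : ((NormedSpace.exp S₀ : evenPart 𝕜 Γ) : GrassmannAlgebra 𝕜 Γ) = grassmannExp (S₀ : GrassmannAlgebra 𝕜 Γ) := by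
    rw [hexpS₀, AddSubmonoidClass.coe_finsetSum, grassmannExp, IsNilpotent.exp_eq_sum hS₀nilA]
    exact sum_congr rfl fun d _ => by rw [coe_qsmul_evenPart, SubmonoidClass.coe_pow, Rat.cast_smul_eq_qsmul]
  -- (7) the effective action is `-S₀`
  have heff : effAction 𝕜 C V = -(S₀ : GrassmannAlgebra 𝕜 Γ) := by
    rw [effAction_def, hratio, hcoe_expS₀, grassmannLog1p_grassmannExp_sub_one 𝕜 ⟨_, hS₀nilA⟩]
  -- (8) kernels
  refine ⟨hunit, @fun m hm Y => ?_⟩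
  set T : evenPart 𝕜 Γ →ₗ[𝕜] 𝕜 := (kernelLM 𝕜 Γ m Y).comp (evenPart 𝕜 Γ).val.toLinearMap with hT
  have hTc : Continuous T := T.continuous_of_finiteDimensional
  have hTS : kernel 𝕜 (S : GrassmannAlgebra 𝕜 Γ) m Y = ∑' n, (if n = 0 then 0 else
      ((n ! : 𝕜))⁻¹ * kernel 𝕜 ((cumulantOf μ n : evenPart 𝕜 Γ) : GrassmannAlgebra 𝕜 Γ) m Y) := by
    have h := (⟨T, hTc⟩ : evenPart 𝕜 Γ →L[𝕜] 𝕜).map_tsum hK.summable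
    change T S = ∑' n, T (coeff n (egfPos (cumulantOf μ))) at h
    rw [show kernel 𝕜 (S : GrassmannAlgebra 𝕜 Γ) m Y = T S from rfl, h]
    refine tsum_congr fun n => ?_
    rw [hT, LinearMap.comp_apply, egfPos, coeff_egf, ← Algebra.smul_def]
    show kernel 𝕜 ((((n ! : ℚ)⁻¹) • (if n = 0 then (0 : evenPart 𝕜 Γ) else cumulantOf μ n) : evenPart 𝕜 Γ) : GrassmannAlgebra 𝕜 Γ) m Y = _
    rw [coe_qsmul_evenPart, kernel_smul]
    split_ifs with hn
    · rw [ZeroMemClass.coe_zero, kernel_zero_right, mul_zero]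
    · rw [Rat.cast_inv, Rat.cast_natCast]
  rw [heff, show (-(S₀ : GrassmannAlgebra 𝕜 Γ)) = (-1 : 𝕜) • (S₀ : GrassmannAlgebra 𝕜 Γ) by rw [neg_one_smul], kernel_smul,
    neg_one_mul, hS₀, AddSubgroupClass.coe_sub, Subalgebra.coe_algebraMap,
    show kernel 𝕜 ((S : GrassmannAlgebra 𝕜 Γ) - algebraMap 𝕜 (GrassmannAlgebra 𝕜 Γ) c) m Y =
      kernel 𝕜 (S : GrassmannAlgebra 𝕜 Γ) m Y - kernel 𝕜 (algebraMap 𝕜 (GrassmannAlgebra 𝕜 Γ) c) m Y from map_sub (kernelLM 𝕜 Γ m Y) _ _,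
    kernel_algebraMap_eq_zero 𝕜 Γ c hm Y, sub_zero, hTS]

end Banach

end Literature.MathematicalPhysics.QuantumLattice
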